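import Summits.QuantumAdvantage.QuantumAdvantage.Theorems.CubicForrelationNearExactIsExactTwelveLevelFiveAlphaIsoPrep

/-!
# Crux `CubicForrelation.NearExactIsExact` (stmt-QuantumAdvantage-14043) — n = 12, open window, a LEVEL-5 side in CASE α: ISOTROPY —
  `V₁` is totally isotropic for the relative symplectic form of the twisted sign bit; hence `hb` is relatively AFFINE on every
  `V₁`-coset of `P` and the sign character sums `Σ_P σ₅ χ_y` are multiples of `256`

Certificate seat `b2b-cforr-cert` (gen 30).  HONEST FRAMING: kernel-checked finite-slice lemmas (standard axioms) about cubic Boolean pairs on 12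
bits (the structural heart of the case-α kill).  NO value of `θ₁₂` claimed; NOT summit progress.

Setting as in …AlphaEta / …AlphaIsoPrep (`hb' = hb ⊕ [4 ∤ e(· ⊕ t₀)]`, `t₀ ∉ V`; `B'(p,q)` its base-free second difference at `x₀`).
* `tzi_block`: on a 2-flat `b ⊕ ⟨w₁, w₂⟩ ⊂ P` (`wᵢ ∈ V₁`) the signs of `hb` and `hb'` differ by the constant factor `sZ [4 ∤ e(b ⊕ t₀)]`.
* `tzi_iso` (**isotropy**): `B'(w₁, w₂) = 0` for `w₁, w₂ ∈ V₁`.  [Frame `(t₁, t₂, w₁, w₂)` with `t₁, t₂, t₁⊕t₂ ∉ V₁`; by `tzi_H4w` and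
  `#L₅ ≤ 63`, `8 ∣ Σ σ₅` on two clean translates — one missing the coset `K = (A₂ ⊕ t₀) ∩ P` (so `Σ sZ∘hb' ≡ 0 (mod 8)` there, which by
  `ws_sum4_mod8` is a frame invariant), one meeting `K` in exactly one 2-flat block, whose `hb'`-parity is therefore even.]
* `tzi_coset_affine`: `hb(x ⊕ w₁ ⊕ w₂) = hb(x) ⊕ hb(x ⊕ w₁) ⊕ hb(x ⊕ w₂)` for `x ∈ P`, `w₁, w₂ ∈ V₁`.
* `tzi_sigma_char`: `Σ_{x∈P} σ₅(x)(−1)^{x·y} ∈ 256ℤ` for every `y` (`P` is a union of `V₁`-cosets; `tzb_coset_char` on each).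

References: MacWilliams–Sloane (1977) Ch. 15 §2 (symplectic forms of quadratic Boolean functions); C. Carlet (2021) §5.2; R. O'Donnell (2014)
§1.4.  Axioms: the standard three.
-/

set_option linter.dupNamespace false -- D-0017: single-problem summit ⇒ `QuantumAdvantage.QuantumAdvantage` by design

noncomputable section

namespace Summit.QuantumAdvantage.QuantumAdvantage.Theorems.CubicForrelation.NearExactIsExact

open Finset
open Literature.Computability.QuantumComplexity
open Literature.Computability.QuantumComplexity.BuzetChailloux (bxor zeroVec bxor_bxor_cancel_left bxor_zeroVec zeroVec_bxor bxor_comm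
  bxor_self)
open Literature.Computability.QuantumComplexity.DerivativeWalsh (W)
open Summit.QuantumAdvantage.QuantumAdvantage.Theorems.CubicForrelation.ExactPairsMaioranaMcFarland (dv_bxor_right_comm)

/-- Four signs summing to `0 mod 4` have an even number of `−1`s. [folklore] -/
theorem tzi_xor4_of_dvd {b₀ b₁ b₂ b₃ : Bool} (h : (4 : ℤ) ∣ sZ b₀ + sZ b₁ + (sZ b₂ + sZ b₃)) :
    (b₀ ^^ b₁ ^^ b₂ ^^ b₃) = false := by
  revert h b₀ b₁ b₂ b₃
  decide

/-- **Block sign.**  `x ∈ P`, `w₁, w₂ ∈ V₁`, `t₀ ∉ V`: on the 2-flat `{b, b⊕w₁, b⊕w₂, b⊕w₁⊕w₂}` the bit `[4 ∤ e(· ⊕ t₀)]` is constant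
(`V₁` preserves `4 ∣ e` off `P`), so the `hb`-sign sum is `sZ [4 ∤ e(b ⊕ t₀)]` times the `hb'`-sign sum. [this work] -/
theorem tzi_block (f : (Fin (6 + 6) → Bool) → Bool) (u' : (Fin (6 + 6) → Bool) → ℤ)
    (V : Finset (Fin (6 + 6) → Bool)) (x₀ : Fin (6 + 6) → Bool) (h0 : zeroVec ∈ V) (hadd : ∀ a ∈ V, ∀ b ∈ V, bxor a b ∈ V)
    (hP : (univ.filter fun x : Fin (6 + 6) → Bool => Odd (u' x)) = V.image (bxor x₀))
    (V₁ : Finset (Fin (6 + 6) → Bool)) (h1add : ∀ a ∈ V₁, ∀ b ∈ V₁, bxor a b ∈ V₁)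
    (hper : ∀ v ∈ V₁, ∀ y, ¬ Odd (u' y) →
      ((4 : ℤ) ∣ u' (bxor y v) - 2 * sZ (f (bxor y v)) ↔ (4 : ℤ) ∣ u' y - 2 * sZ (f y)))
    {t₀ : Fin (6 + 6) → Bool} (ht₀ : t₀ ∉ V) {b w₁ w₂ : Fin (6 + 6) → Bool} (hb₀ : Odd (u' b)) (hw₁ : w₁ ∈ V₁) (hw₂ : w₂ ∈ V₁) :
    sZ (decide ((u' b - 2 * sZ (f b)) % 4 = 3)) + sZ (decide ((u' (bxor b w₁) - 2 * sZ (f (bxor b w₁))) % 4 = 3)) +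
      (sZ (decide ((u' (bxor b w₂) - 2 * sZ (f (bxor b w₂))) % 4 = 3)) +
        sZ (decide ((u' (bxor (bxor b w₁) w₂) - 2 * sZ (f (bxor (bxor b w₁) w₂))) % 4 = 3))) =
      sZ (decide (¬ (4 : ℤ) ∣ u' (bxor b t₀) - 2 * sZ (f (bxor b t₀)))) *
        ((fun z => sZ (decide ((u' z - 2 * sZ (f z)) % 4 = 3) ^^ decide (¬ (4 : ℤ) ∣ u' (bxor z t₀) - 2 * sZ (f (bxor z t₀))))) b +
          (fun z => sZ (decide ((u' z - 2 * sZ (f z)) % 4 = 3) ^^ decide (¬ (4 : ℤ) ∣ u' (bxor z t₀) - 2 * sZ (f (bxor z t₀)))))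
            (bxor b w₁) +
          ((fun z => sZ (decide ((u' z - 2 * sZ (f z)) % 4 = 3) ^^ decide (¬ (4 : ℤ) ∣ u' (bxor z t₀) - 2 * sZ (f (bxor z t₀)))))
            (bxor b w₂) +
           (fun z => sZ (decide ((u' z - 2 * sZ (f z)) % 4 = 3) ^^ decide (¬ (4 : ℤ) ∣ u' (bxor z t₀) - 2 * sZ (f (bxor z t₀)))))
            (bxor (bxor b w₁) w₂))) := by
  classical
  set e : (Fin (6 + 6) → Bool) → ℤ := fun x => u' x - 2 * sZ (f x) with hedef
  set hb : (Fin (6 + 6) → Bool) → Bool := fun z => decide (e z % 4 = 3) with hbdef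
  set hA : (Fin (6 + 6) → Bool) → Bool := fun z => decide (¬ (4 : ℤ) ∣ e z) with hAdef
  have hbP : b ∈ univ.filter (fun x : Fin (6 + 6) → Bool => Odd (u' x)) := mem_filter.2 ⟨mem_univ _, hb₀⟩
  have hy : ¬ Odd (u' (bxor b t₀)) := fun h => fl1_coset_out h0 hadd hP hbP ht₀ (mem_filter.2 ⟨mem_univ _, h⟩)
  have hconst : ∀ ω ∈ V₁, hA (bxor (bxor b ω) t₀) = hA (bxor b t₀) := by
    intro ω hω
    rw [dv_bxor_right_comm b ω t₀]
    simp only [hA, e, hper ω hω _ hy]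
  have hpt : ∀ z, sZ (hb z) = sZ (hA (bxor z t₀)) * sZ (hb z ^^ hA (bxor z t₀)) := by
    intro z; cases hb z <;> cases hA (bxor z t₀) <;> simp [sZ]
  have h12 : bxor (bxor b w₁) w₂ = bxor b (bxor w₁ w₂) := iw_bxor_assoc b w₁ w₂
  show sZ (hb b) + sZ (hb (bxor b w₁)) + (sZ (hb (bxor b w₂)) + sZ (hb (bxor (bxor b w₁) w₂))) =
    sZ (hA (bxor b t₀)) * (sZ (hb b ^^ hA (bxor b t₀)) + sZ (hb (bxor b w₁) ^^ hA (bxor (bxor b w₁) t₀)) +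
      (sZ (hb (bxor b w₂) ^^ hA (bxor (bxor b w₂) t₀)) + sZ (hb (bxor (bxor b w₁) w₂) ^^ hA (bxor (bxor (bxor b w₁) w₂) t₀))))
  rw [hpt b, hpt (bxor b w₁), hpt (bxor b w₂), hpt (bxor (bxor b w₁) w₂), h12, hconst w₁ hw₁, hconst w₂ hw₂,
    hconst _ (h1add w₁ hw₁ w₂ hw₂)]
  ring

/-- **Isotropy of `V₁`.**  On the window in case α (`A₂ = c ⊕ V₁`, `#L₅ ≤ 63`, `#S_R ≤ 31`), with `t₀ ∉ V` and
`hb' = hb ⊕ [4 ∤ e(· ⊕ t₀)]`: the base-free second difference `B'(w₁, w₂) = hb' x₀ ⊕ hb'(x₀⊕w₁) ⊕ hb'(x₀⊕w₂) ⊕ hb'(x₀⊕w₁⊕w₂)` vanishes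
for all `w₁, w₂ ∈ V₁`.  Finite-slice statement, NOT summit progress. [this work] -/
theorem tzi_iso (f g : (Fin (6 + 6) → Bool) → Bool) (hf : IsDegLeFun 3 f) (hg : IsDegLeFun 3 g)
    (u' : (Fin (6 + 6) → Bool) → ℤ) (hu' : ∀ x, W (fun y => signOf (g y)) x = (2 : ℝ) ^ 5 * (u' x : ℝ))
    (V : Finset (Fin (6 + 6) → Bool)) (x₀ : Fin (6 + 6) → Bool) (h0 : zeroVec ∈ V) (hadd : ∀ a ∈ V, ∀ b ∈ V, bxor a b ∈ V)
    (hcardV : #V = 2048) (hP : (univ.filter fun x : Fin (6 + 6) → Bool => Odd (u' x)) = V.image (bxor x₀))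
    (c : Fin (6 + 6) → Bool) (V₁ : Finset (Fin (6 + 6) → Bool)) (hsub : V₁ ⊆ V) (h10 : zeroVec ∈ V₁)
    (h1add : ∀ a ∈ V₁, ∀ b ∈ V₁, bxor a b ∈ V₁) (h1card : #V₁ = 256)
    (hPc : (univ.filter fun x : Fin (6 + 6) → Bool => ¬ Odd (u' x)) = V.image (bxor c))
    (hA2 : (univ.filter fun y : Fin (6 + 6) → Bool => ¬ Odd (u' y) ∧ ¬ (4 : ℤ) ∣ u' y - 2 * sZ (f y)) = V₁.image (bxor c))
    (hper : ∀ v ∈ V₁, ∀ y, ¬ Odd (u' y) →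
      ((4 : ℤ) ∣ u' (bxor y v) - 2 * sZ (f (bxor y v)) ↔ (4 : ℤ) ∣ u' y - 2 * sZ (f y)))
    (hbud : ∑ x ∈ univ.filter (fun x : Fin (6 + 6) → Bool => Odd (u' x)), ((u' x - 2 * sZ (f x)) ^ 2 - 1) +
        ∑ y ∈ univ.filter (fun y : Fin (6 + 6) → Bool => ¬ Odd (u' y)), (u' y - 2 * sZ (f y)) ^ 2 ≤ 1535)
    {t₀ : Fin (6 + 6) → Bool} (ht₀ : t₀ ∉ V) {w₁ w₂ : Fin (6 + 6) → Bool} (hw₁ : w₁ ∈ V₁) (hw₂ : w₂ ∈ V₁) :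
    ((fun z => decide ((u' z - 2 * sZ (f z)) % 4 = 3) ^^ decide (¬ (4 : ℤ) ∣ u' (bxor z t₀) - 2 * sZ (f (bxor z t₀)))) x₀ ^^
     (fun z => decide ((u' z - 2 * sZ (f z)) % 4 = 3) ^^ decide (¬ (4 : ℤ) ∣ u' (bxor z t₀) - 2 * sZ (f (bxor z t₀)))) (bxor x₀ w₁) ^^
     (fun z => decide ((u' z - 2 * sZ (f z)) % 4 = 3) ^^ decide (¬ (4 : ℤ) ∣ u' (bxor z t₀) - 2 * sZ (f (bxor z t₀)))) (bxor x₀ w₂) ^^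
     (fun z => decide ((u' z - 2 * sZ (f z)) % 4 = 3) ^^ decide (¬ (4 : ℤ) ∣ u' (bxor z t₀) - 2 * sZ (f (bxor z t₀))))
       (bxor (bxor x₀ w₁) w₂)) = false := by
  classical
  set e : (Fin (6 + 6) → Bool) → ℤ := fun x => u' x - 2 * sZ (f x) with hedef
  set hb : (Fin (6 + 6) → Bool) → Bool := fun z => decide (e z % 4 = 3) with hbdef
  set hA : (Fin (6 + 6) → Bool) → Bool := fun z => decide (¬ (4 : ℤ) ∣ e z) with hAdef
  set hb' : (Fin (6 + 6) → Bool) → Bool := fun z => hb z ^^ hA (bxor z t₀) with hb'def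
  set P := univ.filter (fun x : Fin (6 + 6) → Bool => Odd (u' x)) with hPdef
  set A₂ := V₁.image (bxor c) with hA₂def
  set H₀ := V.image (bxor c) with hH₀def
  set K₀ := A₂.image (fun a => bxor a t₀) with hK₀def
  set L := univ.filter (fun x : Fin (6 + 6) → Bool => Odd (u' x) ∧ ¬ (8 : ℤ) ∣ e x - sZ (decide (e x % 4 = 3))) with hLdef
  have hmemP : ∀ x, x ∈ P ↔ Odd (u' x) := fun x => by simp [hPdef]
  have hPV : ∀ x, Odd (u' x) → ∀ a ∈ V, Odd (u' (bxor x a)) := by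
    intro x hx a ha
    have h := fl1_coset_vadd hadd hP (mem_filter.2 ⟨mem_univ _, hx⟩) ha
    exact (mem_filter.1 h).2
  have hPcard : #P = 2048 := by rw [hP, card_image_of_injective _ (iw_bxor_injective x₀), hcardV]
  have hA2card : #A₂ = 256 := by rw [hA₂def, card_image_of_injective _ (iw_bxor_injective c), h1card]
  have hK₀card : #K₀ = 256 := by
    rw [hK₀def, card_image_of_injective _ (fun a b (h : bxor a t₀ = bxor b t₀) => ?_), hA2card]
    have := congrArg (fun v => bxor v t₀) h
    simpa [iw_bxor_assoc] using this
  have hL : #L ≤ 63 := tzi_L5_card f u' c V₁ h1card hA2 hbud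
  have hsd := tzi_hsd f g hf hg u' hu' V x₀ h0 hadd hP ht₀
  change ∀ x, Odd (u' x) → ∀ p ∈ V, ∀ q ∈ V, hb' (bxor (bxor x p) q) =
    (hb' x ^^ hb' (bxor x p) ^^ hb' (bxor x q) ^^ (hb' x₀ ^^ hb' (bxor x₀ p) ^^ hb' (bxor x₀ q) ^^ hb' (bxor (bxor x₀ p) q))) at hsd
  show (hb' x₀ ^^ hb' (bxor x₀ w₁) ^^ hb' (bxor x₀ w₂) ^^ hb' (bxor (bxor x₀ w₁) w₂)) = false
  -- `A₂ ⊆ H₀`, `K₀ ⊆ P`; the value of `hA(· ⊕ t₀)` on `P`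
  have hA₂H₀ : A₂ ⊆ H₀ := image_subset_image hsub
  have hH₀ev : ∀ y ∈ H₀, ¬ Odd (u' y) := fun y hy => by rw [← hPc] at hy; exact (mem_filter.1 hy).2
  have hAtrue : ∀ b, bxor b t₀ ∈ A₂ → hA (bxor b t₀) = true := by
    intro b hb₁
    rw [← hA2] at hb₁
    simp only [hA, e, (mem_filter.1 hb₁).2.2, decide_true, not_false_eq_true]
  have hAfalse : ∀ b, Odd (u' b) → bxor b t₀ ∉ A₂ → hA (bxor b t₀) = false := by
    intro b hb₀ hb₁
    have hoff : ¬ Odd (u' (bxor b t₀)) := fun h =>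
      fl1_coset_out h0 hadd hP (mem_filter.2 ⟨mem_univ _, hb₀⟩) ht₀ (mem_filter.2 ⟨mem_univ _, h⟩)
    rw [← hA2] at hb₁
    have h4 : (4 : ℤ) ∣ e (bxor b t₀) := by
      by_contra h4; exact hb₁ (mem_filter.2 ⟨mem_univ _, hoff, h4⟩)
    simp only [hA, h4, not_true_eq_false, decide_false]
  have hK₀P : ∀ b ∈ K₀, Odd (u' b) := by
    intro b hb₁
    obtain ⟨a, ha, rfl⟩ := mem_image.1 hb₁
    by_contra hev
    have h1 : bxor a t₀ ∈ H₀ := by rw [← hPc]; exact mem_filter.2 ⟨mem_univ _, hev⟩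
    exact fl1_coset_out h0 hadd rfl (hA₂H₀ ha) ht₀ h1
  have hK₀A : ∀ b ∈ K₀, bxor b t₀ ∈ A₂ := by
    intro b hb₁
    obtain ⟨a, ha, rfl⟩ := mem_image.1 hb₁
    rwa [iw_bxor_assoc, bxor_self, bxor_zeroVec]
  have hnotK₀ : ∀ b, b ∉ K₀ → bxor b t₀ ∉ A₂ := by
    intro b hb₁ h
    exact hb₁ (mem_image.2 ⟨_, h, by rw [iw_bxor_assoc, bxor_self, bxor_zeroVec]⟩)
  -- `L`-free 2-flat blocks and their shadow
  set SH := (L ∪ L.image (fun l => bxor l w₁)) ∪ (L.image (fun l => bxor l w₂) ∪ L.image (fun l => bxor (bxor l w₂) w₁)) with hSHdef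
  have hSHcard : #SH ≤ 252 := by
    have hu : #SH ≤ (#L + #L) + (#L + #L) := by
      refine (card_union_le _ _).trans (Nat.add_le_add ?_ ?_)
      · exact (card_union_le _ _).trans (Nat.add_le_add_left card_image_le _)
      · exact (card_union_le _ _).trans (Nat.add_le_add card_image_le card_image_le)
    omega
  have hfree : ∀ b, b ∉ SH → b ∉ L ∧ bxor b w₁ ∉ L ∧ bxor b w₂ ∉ L ∧ bxor (bxor b w₁) w₂ ∉ L := by
    intro b hb₁
    simp only [hSHdef, mem_union, not_or] at hb₁
    obtain ⟨⟨h1, h2⟩, h3, h4⟩ := hb₁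
    refine ⟨h1, fun h => h2 (mem_image.2 ⟨_, h, ?_⟩), fun h => h3 (mem_image.2 ⟨_, h, ?_⟩), fun h => h4 (mem_image.2 ⟨_, h, ?_⟩)⟩
    · rw [iw_bxor_assoc, bxor_self, bxor_zeroVec]
    · rw [iw_bxor_assoc, bxor_self, bxor_zeroVec]
    · show bxor (bxor (bxor (bxor b w₁) w₂) w₂) w₁ = b
      rw [iw_bxor_assoc (bxor b w₁), bxor_self, bxor_zeroVec, iw_bxor_assoc, bxor_self, bxor_zeroVec]
  -- `8 ∣ e − σ₅` at the four points of an `L`-free block in `P`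
  have hmod8 : ∀ z, Odd (u' z) → z ∉ L → (8 : ℤ) ∣ e z - sZ (hb z) := by
    intro z hz hzL
    by_contra h8
    exact hzL (mem_filter.2 ⟨mem_univ _, hz, h8⟩)
  -- Step A: a base point `x₂ ∈ K₀` with an `L`-free block
  obtain ⟨x₂, hx₂K, hx₂S⟩ : ∃ x, x ∈ K₀ ∧ x ∉ SH := exists_mem_notMem_of_card_lt_card (by omega)
  have hx₂ : Odd (u' x₂) := hK₀P x₂ hx₂K
  -- Step B: `t₁ ∈ V ∖ V₁` with the block at `x₂ ⊕ t₁` `L`-free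
  set B₁ := V₁ ∪ SH.image (bxor x₂) with hB₁def
  obtain ⟨t₁, ht₁V, ht₁B⟩ : ∃ t, t ∈ V ∧ t ∉ B₁ := exists_mem_notMem_of_card_lt_card (by
    have hu : #B₁ ≤ #V₁ + #SH := (card_union_le _ _).trans (Nat.add_le_add_left card_image_le _)
    omega)
  simp only [hB₁def, mem_union, not_or] at ht₁B
  obtain ⟨ht₁V₁, ht₁S⟩ := ht₁B
  have himg : ∀ (s q : Fin (6 + 6) → Bool), q ∉ SH.image (bxor s) → bxor s q ∉ SH := by
    intro s q h hmem; exact h (mem_image.2 ⟨_, hmem, bxor_bxor_cancel_left s q⟩)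
  -- Step C: `t₂ ∈ V` with `t₂, t₁ ⊕ t₂ ∉ V₁` and the blocks at `x₂ ⊕ t₂`, `x₂ ⊕ t₁ ⊕ t₂` `L`-free
  set B₂ := (V₁ ∪ V₁.image (bxor t₁)) ∪ (SH.image (bxor x₂) ∪ SH.image (bxor (bxor x₂ t₁))) with hB₂def
  obtain ⟨t₂, ht₂V, ht₂B⟩ : ∃ t, t ∈ V ∧ t ∉ B₂ := exists_mem_notMem_of_card_lt_card (by
    have hu : #B₂ ≤ (#V₁ + #V₁) + (#SH + #SH) := by
      refine (card_union_le _ _).trans (Nat.add_le_add ?_ ?_)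
      · exact (card_union_le _ _).trans (Nat.add_le_add_left card_image_le _)
      · exact (card_union_le _ _).trans (Nat.add_le_add card_image_le card_image_le)
    omega)
  simp only [hB₂def, mem_union, not_or] at ht₂B
  obtain ⟨⟨ht₂V₁, ht₁₂B⟩, ht₂S, ht₁₂S⟩ := ht₂B
  have ht₁₂V₁ : bxor t₁ t₂ ∉ V₁ := fun h => ht₁₂B (mem_image.2 ⟨_, h, bxor_bxor_cancel_left t₁ t₂⟩)
  have ht₁₂V : bxor t₁ t₂ ∈ V := hadd t₁ ht₁V t₂ ht₂V
  -- Step D: a base point `x₁ ∈ P` whose translate misses `K₀` and is `L`-free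
  set B₃ := ((K₀ ∪ K₀.image (fun k => bxor k t₂)) ∪ (K₀.image (fun k => bxor k t₁) ∪ K₀.image (fun k => bxor (bxor k t₂) t₁))) ∪
    ((SH ∪ SH.image (fun s => bxor s t₂)) ∪ (SH.image (fun s => bxor s t₁) ∪ SH.image (fun s => bxor (bxor s t₂) t₁))) with hB₃def
  obtain ⟨x₁, hx₁P, hx₁B⟩ : ∃ x, x ∈ P ∧ x ∉ B₃ := exists_mem_notMem_of_card_lt_card (by
    have hu : #B₃ ≤ ((#K₀ + #K₀) + (#K₀ + #K₀)) + ((#SH + #SH) + (#SH + #SH)) := by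
      refine (card_union_le _ _).trans (Nat.add_le_add ?_ ?_)
      · refine (card_union_le _ _).trans (Nat.add_le_add ?_ ?_)
        · exact (card_union_le _ _).trans (Nat.add_le_add_left card_image_le _)
        · exact (card_union_le _ _).trans (Nat.add_le_add card_image_le card_image_le)
      · refine (card_union_le _ _).trans (Nat.add_le_add ?_ ?_)
        · exact (card_union_le _ _).trans (Nat.add_le_add_left card_image_le _)
        · exact (card_union_le _ _).trans (Nat.add_le_add card_image_le card_image_le)
    omega)
  have hx₁ : Odd (u' x₁) := (hmemP x₁).1 hx₁P
  simp only [hB₃def, mem_union, not_or] at hx₁B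
  obtain ⟨⟨⟨hx₁K0, hx₁K2⟩, hx₁K1, hx₁K21⟩, ⟨hx₁S0, hx₁S2⟩, hx₁S1, hx₁S21⟩ := hx₁B
  have himg' : ∀ (S : Finset (Fin (6 + 6) → Bool)) (s q : Fin (6 + 6) → Bool), q ∉ S.image (fun k => bxor k s) → bxor q s ∉ S := by
    intro S s q h hmem; exact h (mem_image.2 ⟨_, hmem, by rw [iw_bxor_assoc, bxor_self, bxor_zeroVec]⟩)
  have himg'' : ∀ (S : Finset (Fin (6 + 6) → Bool)) (q : Fin (6 + 6) → Bool), q ∉ S.image (fun k => bxor (bxor k t₂) t₁) →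
      bxor (bxor q t₁) t₂ ∉ S := by
    intro S q h hmem
    refine h (mem_image.2 ⟨_, hmem, ?_⟩)
    show bxor (bxor (bxor (bxor q t₁) t₂) t₂) t₁ = q
    rw [iw_bxor_assoc (bxor q t₁), bxor_self, bxor_zeroVec, iw_bxor_assoc, bxor_self, bxor_zeroVec]
  -- peeling a 4-flat sum with directions `(t₁, t₂, w₂, w₁)` into four blocks
  have hpeel : ∀ (F : (Fin (6 + 6) → Bool) → ℤ) (x : Fin (6 + 6) → Bool),
      ∑ ε : Fin 4 → Bool, F (fun j => x j ^^ decide (Odd #(univ.filter fun i =>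
        ε i && (![t₁, t₂, w₂, w₁] : Fin 4 → Fin (6 + 6) → Bool) i j))) =
      (F x + F (bxor x w₁) + (F (bxor x w₂) + F (bxor (bxor x w₁) w₂))) +
        (F (bxor x t₂) + F (bxor (bxor x t₂) w₁) + (F (bxor (bxor x t₂) w₂) + F (bxor (bxor (bxor x t₂) w₁) w₂))) +
      ((F (bxor x t₁) + F (bxor (bxor x t₁) w₁) + (F (bxor (bxor x t₁) w₂) + F (bxor (bxor (bxor x t₁) w₁) w₂))) +
        (F (bxor (bxor x t₁) t₂) + F (bxor (bxor (bxor x t₁) t₂) w₁) +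
          (F (bxor (bxor (bxor x t₁) t₂) w₂) + F (bxor (bxor (bxor (bxor x t₁) t₂) w₁) w₂)))) := by
    intro F x
    have e4 : (![t₁, t₂, w₂, w₁] : Fin 4 → Fin (6 + 6) → Bool) = Fin.cons t₁ ![t₂, w₂, w₁] := rfl
    have e3 : (![t₂, w₂, w₁] : Fin 3 → Fin (6 + 6) → Bool) = Fin.cons t₂ ![w₂, w₁] := rfl
    rw [e4, l5c_sum_split F x t₁ ![t₂, w₂, w₁], e3, l5c_sum_split F x t₂ ![w₂, w₁], l5c_sum_split F (bxor x t₁) t₂ ![w₂, w₁],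
      tzb_sum2, tzb_sum2, tzb_sum2, tzb_sum2]
  -- the frame invariant `Σ sZ∘hb' (mod 8)` (`ws_sum4_mod8`)
  have hw₁V : w₁ ∈ V := hsub hw₁
  have hw₂V : w₂ ∈ V := hsub hw₂
  have hws : ∀ x, Odd (u' x) →
      (∑ ε : Fin 4 → Bool, sZ (hb' (fun j => x j ^^ decide (Odd #(univ.filter fun i =>
        ε i && (![t₁, t₂, w₂, w₁] : Fin 4 → Fin (6 + 6) → Bool) i j))))) % 8 =
      (∑ ε : Fin 4 → Bool, sZ (hb' (fun j => x₁ j ^^ decide (Odd #(univ.filter fun i =>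
        ε i && (![t₁, t₂, w₂, w₁] : Fin 4 → Fin (6 + 6) → Bool) i j))))) % 8 := by
    intro x hx
    rw [ws_sum4_mod8 V (fun z => Odd (u' z)) x₀ hb' hPV hsd hx ht₁V ht₂V hw₂V hw₁V,
      ws_sum4_mod8 V (fun z => Odd (u' z)) x₀ hb' hPV hsd hx₁ ht₁V ht₂V hw₂V hw₁V]
  -- from `8 ∣ Σ e` to `8 ∣ Σ sZ∘hb` on an `L`-free translate
  have hconv : ∀ x, Odd (u' x) → x ∉ SH → bxor x t₂ ∉ SH → bxor x t₁ ∉ SH → bxor (bxor x t₁) t₂ ∉ SH →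
      (8 : ℤ) ∣ (sZ (hb x) + sZ (hb (bxor x w₁)) + (sZ (hb (bxor x w₂)) + sZ (hb (bxor (bxor x w₁) w₂)))) +
        (sZ (hb (bxor x t₂)) + sZ (hb (bxor (bxor x t₂) w₁)) + (sZ (hb (bxor (bxor x t₂) w₂)) + sZ (hb (bxor (bxor (bxor x t₂) w₁) w₂)))) +
      ((sZ (hb (bxor x t₁)) + sZ (hb (bxor (bxor x t₁) w₁)) + (sZ (hb (bxor (bxor x t₁) w₂)) + sZ (hb (bxor (bxor (bxor x t₁) w₁) w₂)))) +
        (sZ (hb (bxor (bxor x t₁) t₂)) + sZ (hb (bxor (bxor (bxor x t₁) t₂) w₁)) +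
          (sZ (hb (bxor (bxor (bxor x t₁) t₂) w₂)) + sZ (hb (bxor (bxor (bxor (bxor x t₁) t₂) w₁) w₂))))) := by
    intro x hx hS0 hS2 hS1 hS21
    have h8 := tzi_H4w f g hf hg u' hu' V h0 hadd hcardV c V₁ hsub h10 h1add h1card hPc hA2 hbud x ht₁V ht₂V hw₂ hw₁
    change (8 : ℤ) ∣ ∑ ε : Fin 4 → Bool, e (fun j => x j ^^ decide (Odd #(univ.filter fun i =>
        ε i && (![t₁, t₂, w₂, w₁] : Fin 4 → Fin (6 + 6) → Bool) i j))) at h8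
    rw [hpeel e x] at h8
    have hb4 : ∀ b, Odd (u' b) → b ∉ SH →
        (8 : ℤ) ∣ (e b + e (bxor b w₁) + (e (bxor b w₂) + e (bxor (bxor b w₁) w₂))) -
          (sZ (hb b) + sZ (hb (bxor b w₁)) + (sZ (hb (bxor b w₂)) + sZ (hb (bxor (bxor b w₁) w₂)))) := by
      intro b hb₀ hbS
      obtain ⟨h1, h2, h3, h4⟩ := hfree b hbS
      have d1 := hmod8 b hb₀ h1
      have d2 := hmod8 _ (hPV b hb₀ w₁ hw₁V) h2
      have d3 := hmod8 _ (hPV b hb₀ w₂ hw₂V) h3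
      have d4 := hmod8 _ (hPV _ (hPV b hb₀ w₁ hw₁V) w₂ hw₂V) h4
      have := dvd_add (dvd_add d1 d2) (dvd_add d3 d4)
      omega
    have e0 := hb4 x hx hS0
    have e2 := hb4 _ (hPV x hx t₂ ht₂V) hS2
    have e1 := hb4 _ (hPV x hx t₁ ht₁V) hS1
    have e21 := hb4 _ (hPV _ (hPV x hx t₁ ht₁V) t₂ ht₂V) hS21
    have := dvd_sub h8 (dvd_add (dvd_add e0 e2) (dvd_add e1 e21))
    omega
  -- block signs
  have hblk : ∀ b, Odd (u' b) → sZ (hb b) + sZ (hb (bxor b w₁)) + (sZ (hb (bxor b w₂)) + sZ (hb (bxor (bxor b w₁) w₂))) =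
      sZ (hA (bxor b t₀)) * (sZ (hb' b) + sZ (hb' (bxor b w₁)) + (sZ (hb' (bxor b w₂)) + sZ (hb' (bxor (bxor b w₁) w₂)))) :=
    fun b hb₀ => tzi_block f u' V x₀ h0 hadd hP V₁ h1add hper ht₀ hb₀ hw₁ hw₂
  -- case (i): the translate through `x₁` misses `K₀`
  have hx₁sum := hconv x₁ hx₁ hx₁S0 (himg' SH t₂ x₁ hx₁S2) (himg' SH t₁ x₁ hx₁S1) (himg'' SH x₁ hx₁S21)
  rw [hblk x₁ hx₁, hblk _ (hPV x₁ hx₁ t₂ ht₂V), hblk _ (hPV x₁ hx₁ t₁ ht₁V), hblk _ (hPV _ (hPV x₁ hx₁ t₁ ht₁V) t₂ ht₂V),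
    hAfalse x₁ hx₁ (hnotK₀ x₁ hx₁K0), hAfalse _ (hPV x₁ hx₁ t₂ ht₂V) (hnotK₀ _ (himg' K₀ t₂ x₁ hx₁K2)),
    hAfalse _ (hPV x₁ hx₁ t₁ ht₁V) (hnotK₀ _ (himg' K₀ t₁ x₁ hx₁K1)),
    hAfalse _ (hPV _ (hPV x₁ hx₁ t₁ ht₁V) t₂ ht₂V) (hnotK₀ _ (himg'' K₀ x₁ hx₁K21))] at hx₁sum
  simp only [show sZ false = 1 from rfl, one_mul] at hx₁sum
  rw [← hpeel (fun z => sZ (hb' z)) x₁] at hx₁sum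
  have hx₁mod : (∑ ε : Fin 4 → Bool, sZ (hb' (fun j => x₁ j ^^ decide (Odd #(univ.filter fun i =>
      ε i && (![t₁, t₂, w₂, w₁] : Fin 4 → Fin (6 + 6) → Bool) i j))))) % 8 = 0 := Int.emod_eq_zero_of_dvd hx₁sum
  -- case (ii): the translate through `x₂` meets `K₀` in the block at `x₂` only
  have hx₂sum := hconv x₂ hx₂ hx₂S (himg x₂ t₂ ht₂S) (himg x₂ t₁ ht₁S) (himg _ t₂ ht₁₂S)
  have hx₂A : bxor x₂ t₀ ∈ A₂ := hK₀A x₂ hx₂K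
  have hoffA : ∀ s ∈ V, s ∉ V₁ → bxor (bxor x₂ s) t₀ ∉ A₂ := by
    intro s hs hs1
    rw [dv_bxor_right_comm x₂ s t₀]
    exact fl1_coset_out h10 h1add rfl hx₂A hs1
  have h21 : bxor (bxor x₂ t₁) t₂ = bxor x₂ (bxor t₁ t₂) := iw_bxor_assoc x₂ t₁ t₂
  rw [hblk x₂ hx₂, hblk _ (hPV x₂ hx₂ t₂ ht₂V), hblk _ (hPV x₂ hx₂ t₁ ht₁V), hblk _ (hPV _ (hPV x₂ hx₂ t₁ ht₁V) t₂ ht₂V),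
    hAtrue x₂ hx₂A, hAfalse _ (hPV x₂ hx₂ t₂ ht₂V) (hoffA t₂ ht₂V ht₂V₁), hAfalse _ (hPV x₂ hx₂ t₁ ht₁V) (hoffA t₁ ht₁V ht₁V₁)] at hx₂sum
  rw [h21, hAfalse _ (hPV x₂ hx₂ _ ht₁₂V) (hoffA _ ht₁₂V ht₁₂V₁), ← h21] at hx₂sum
  simp only [show sZ false = 1 from rfl, show sZ true = -1 from rfl, one_mul] at hx₂sum
  have hx₂mod : (∑ ε : Fin 4 → Bool, sZ (hb' (fun j => x₂ j ^^ decide (Odd #(univ.filter fun i =>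
      ε i && (![t₁, t₂, w₂, w₁] : Fin 4 → Fin (6 + 6) → Bool) i j))))) % 8 = 0 := by rw [hws x₂ hx₂, hx₁mod]
  have hx₂dvd := Int.dvd_of_emod_eq_zero hx₂mod
  rw [hpeel (fun z => sZ (hb' z)) x₂] at hx₂dvd
  have hblock4 : (4 : ℤ) ∣ sZ (hb' x₂) + sZ (hb' (bxor x₂ w₁)) + (sZ (hb' (bxor x₂ w₂)) + sZ (hb' (bxor (bxor x₂ w₁) w₂))) := by
    omega
  have hpar := tzi_xor4_of_dvd hblock4
  rw [hsd x₂ hx₂ w₁ hw₁V w₂ hw₂V] at hpar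
  revert hpar
  cases hb' x₂ <;> cases hb' (bxor x₂ w₁) <;> cases hb' (bxor x₂ w₂) <;>
    cases (hb' x₀ ^^ hb' (bxor x₀ w₁) ^^ hb' (bxor x₀ w₂) ^^ hb' (bxor (bxor x₀ w₁) w₂)) <;> decide

end Summit.QuantumAdvantage.QuantumAdvantage.Theorems.CubicForrelation.NearExactIsExact

end
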